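import Literature.IUT.HodgeArakelov.GroupTheoreticThetaMonoids
import Literature.IUT.HodgeArakelov.GaloisPairRigidity
import Literature.IUT.HodgeArakelov.RadialGraphs

/-!
# [IUTchII] §3, Prop 3.4 (i): the functor `Π_v ↦ (Π_v ↷ Ψ_env(M^Θ_*(Π_v)))` on the radial category and the
# multiradiality INSTANCE (junction J12 of plan/L6/SUBDAG-IUTchII-Prop-31-33-34)

S. Mochizuki, *Inter-universal Teichmüller theory II*, §3, Proposition 3.4 (i), kurims manuscript pp. 91–92
[cite: Mochizuki2012, Prop 3.4 (i) p.91] (lit key `paper:url-5036b4059555`, read on my own render), final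
clause: "the functorial algorithms `Π_v ↦ Ψ_env(M^Θ_*(Π_v))`; `Π_v ↦ ∞Ψ_env(M^Θ_*(Π_v))` — where we think of
`Ψ_env(M^Θ_*(Π_v))`, `∞Ψ_env(M^Θ_*(Π_v))` as being equipped with their natural `Π_v`-actions and splittings up to
torsion [cf. Proposition 3.1, (i)] — obtained by composing the algorithms of Propositions 1.2, (i); 3.1, (i), are
compatible, relative to the above displayed diagrams, with arbitrary automorphisms of … the pair
`G_v(M^Θ_*(†F_v)) ↷ (Ψ_{†F^Θ_v})^{×μ}` which arise as `Ism`-multiples of automorphisms induced by automorphisms of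
… the pair `G_v(M^Θ_*(†F_v)) ↷ (Ψ_{†F^Θ_v})^×` [cf. Example 1.8, (iv); Remark 1.8.1; Remark 1.11.1, (i), (b)] —
in the sense that the natural functor “`Ψ_ℛ`” of Corollary 1.12, (iii), is multiradially defined."  Claim key
`Mochizuki2012` is DISPUTED (D-0012); this file records and proves, it endorses nothing; no side is taken on
[IUTchIII] Cor 3.12.  abc-iut cell, layer L6, seat abc-iut-w5-d169 (W6-S6 holder lineage), junction **J12**
of `plan/L6/SUBDAG-IUTchII-Prop-31-33-34.md` row P34.i.r20: "write the functor
`Ξ : (HA.ex18iii S Γ).R ⥤ (pairs)` from `TTM.ThetaEnvData`…; its multiradiality is then LITERALLY t1's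
`HA.cor111_multiradiallyDefined S Γ Ξ` (no restatement filed — cite)".

## What is here (precedent shape: `GaloisPairRigidityData.cor111Functor` over its `PiTransport` input)

* `TemperedThetaMonoids.ThetaMonoidDatum S` — the TARGET category of the functorial algorithm: pairs
  `(Π, E)` of an isomorph `Π` of `Π^tp_{X̲̲_k}` (abc-iut-L6-t1's `IsoClass S.PiX`, Ex 1.8 (i)) and theta-environment
  data `E` on `Π` (abc-iut-L6-t2's `TemperedThetaMonoids.ThetaEnvData`, the INPUT record of Prop 3.1: ambient module
  `lim_J H¹(…)`, conjugation action, `M^×_TM`, `M_TM`, `θ^ι_env`, `∞θ^ι_env`, hence the theta monoids `Ψ^ι_env`,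
  `∞Ψ^ι_env`); morphisms = "compatible collections of isomorphisms" of the first display of Prop 3.4 (i): an
  isomorphism of topological groups `ψ : Π ⥲ Π*` together with an isomorphism of theta-environment data along it
  (`ThetaEnvData.Iso`, GroupTheoreticThetaMonoids) — a groupoid.
* `TemperedThetaMonoids.ThetaEnvTransport S` — the INPUT datum (junction J10 of the sub-DAG, as DATA, not as a
  `Prop` fact): a theta-environment datum `E(Π)` for every isomorph `Π` and, for every isomorphism of topological
  groups `Π ⥲ Π*`, the induced isomorphism of data, functorially ("the left-hand square in each diagram arises from
  the functoriality of the algorithms involved, relative to isomorphisms of projective systems of mono-theta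
  environments", p. 91; Prop 1.2 (i): `Π ↦ M^Θ_*(Π)`).  A DEGENERATE inhabitant `ThetaEnvTransport.trivial` certifies
  that the package is consistent; the GENUINE inhabitant is the natural-system record family of abc-iut-w4-d019
  (`EtaleLevels.thetaEnvRecord`, ThetaEnvDataRecordBridge/Model) with its functoriality — not built here.
* `TemperedThetaMonoids.thetaMonoidFunctor T : IsoClass S.PiX ⥤ ThetaMonoidDatum S` — THE functorial algorithm
  `Π_v ↦ (Π_v ↷ {Ψ^ι_env, ∞Ψ^ι_env}_ι, M^×_TM, Ψ_cns)` of Prop 3.4 (i) (functor laws PROVED from the transport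
  laws), with bookkeeping corollaries: its morphisms carry `Ψ^ι_env`, `∞Ψ^ι_env`, `Ψ_cns` onto each other and induce
  abc-iut-L6-t2's isomorphisms of Galois–monoid pairs `splitThetaPairIso` / `inftySplitThetaPairIso` on the output
  pairs (the first display of Prop 3.4 (i)); `prop34iRadialFunctor T Γ` = its composite with the projection
  `(Π, G, α) ↦ Π` of the radial category `ℛ = (ex18iii S Γ).R` of Example 1.8 (iii)/(iv) (`Γ` = the group of
  `Ism`-multiples of Cor 1.12 (iii), abstract as in abc-iut-L6-t1's shape).
* `TemperedThetaMonoids.prop34i_multiradiallyDefined` — **J12**: "the natural functor `Ψ_ℛ` of Corollary 1.12, (iii),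
  is multiradially defined" AT THIS FUNCTOR = abc-iut-L6-t1's shape theorem `cor111_multiradiallyDefined S Γ Ξ`
  (CITED, instantiated, not restated); and the Example 1.9 (ii) form `thetaMonoidFunctor_ex19ii`.

HONEST FRAMING: typed ≠ proved for [IUTchII] as a whole; the multiradiality notion is abc-iut-L6-t1's
`RadialEnvironment` formalism (Ex 1.7), in which "multiradially defined" is a property of the SOURCE environment,
so the content of this file is the CONSTRUCTION of the functor, exactly as the sub-DAG row prescribes; nothing
here asserts abc or takes a side on the disputed step.
-/

namespace Literature.IUT.HodgeArakelov

namespace TemperedThetaMonoids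

open CategoryTheory Literature.AnabelianGeometry.AbsoluteAnabelian

universe u

/-! ### 0. An extensionality lemma for isomorphisms of theta-environment data -/

namespace ThetaEnvData.Iso

variable {P P' : Type u} [Group P] [Group P'] {E : ThetaEnvData.{u, u} P} {E' : ThetaEnvData.{u, u} P'}

/-- Two isomorphisms of theta-environment data with the same group isomorphism, the same module isomorphism
and the same index bijection are equal (the remaining fields are propositions).
[cite: Mochizuki2012, Prop 3.4 (i) p.91] -/
theorem ext' {I J : ThetaEnvData.Iso E E'} (hphi : I.phi = J.phi) (he : I.e = J.e) (hiota : I.iota = J.iota) :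
    I = J := by
  cases I
  cases J
  cases hphi
  cases he
  cases hiota
  rfl

end ThetaEnvData.Iso

variable (S : ThetaSetting.{u})

/-! ### 1. The target category: isomorphs of `Π^tp_{X̲̲_k}` carrying theta-environment data -/

/-- **The output objects of the functorial algorithm of Prop 3.4 (i)** (p. 91): an isomorph `Π` of
`Π^tp_{X̲̲_k}` (Example 1.8 (i): "a topological group `Π` isomorphic to `Π^tp_{X̲̲_k}`") together with
theta-environment data on `Π` — the datum from which "`Π_X(M^Θ_*(Π_v)) ↷ Ψ_env(M^Θ_*(Π_v))`,
`∞Ψ_env(M^Θ_*(Π_v))`" and their splittings are read off (`ThetaEnvData.thetaMonoid`, `inftyThetaMonoid`,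
`splitThetaPair`). [cite: Mochizuki2012, Prop 3.4 (i) p.91] -/
structure ThetaMonoidDatum : Type (u + 1) where
  /-- the isomorph `Π` of `Π^tp_{X̲̲_k}` -/
  P : IsoClass S.PiX
  /-- the theta-environment data `(lim_J H¹(…), conj, M^×_TM, M_TM, θ^ι_env, ∞θ^ι_env)` on `Π` -/
  E : ThetaEnvData.{u, u} P.G

namespace ThetaMonoidDatum

variable {S}

/-- **Morphisms** = the "compatible collections of isomorphisms" of the first display of Prop 3.4 (i)
(p. 91): "the upper horizontal isomorphisms in each diagram are isomorphisms of topological groups; the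
lower/middle horizontal isomorphisms … are isomorphisms of [ind-topological] monoids" — an isomorphism of
topological groups `ψ : Π ⥲ Π*` together with an isomorphism of theta-environment data lying over it.
[cite: Mochizuki2012, Prop 3.4 (i) p.91] -/
@[ext]
structure Hom (X Y : ThetaMonoidDatum S) : Type u where
  /-- the isomorphism of topological groups `Π ⥲ Π*` -/
  iso : X.P ⟶ Y.P
  /-- the isomorphism of theta-environment data along it -/
  I : ThetaEnvData.Iso X.E Y.E
  /-- … lying over `ψ`: its group isomorphism IS `ψ` -/
  phi_eq : ∀ g : X.P.G, I.phi g = IsoClass.homIso iso g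

/-- `ThetaMonoidDatum S` is a category (composition = composition of the isomorphisms; in fact a groupoid,
below). [cite: Mochizuki2012, Prop 3.4 (i) p.91] -/
instance : Category.{u} (ThetaMonoidDatum S) where
  Hom := Hom
  id X := ⟨𝟙 X.P, ThetaEnvData.Iso.refl X.E, fun _ => rfl⟩
  comp f g := ⟨f.iso ≫ g.iso, f.I.trans g.I, fun x => by
    change g.I.phi (f.I.phi x) = IsoClass.homIso g.iso (IsoClass.homIso f.iso x)
    rw [f.phi_eq, g.phi_eq]⟩
  id_comp f := Hom.ext (Category.id_comp _)
    (ThetaEnvData.Iso.ext' (MulEquiv.ext fun _ => rfl) (MulEquiv.ext fun _ => rfl) (Equiv.ext fun _ => rfl))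
  comp_id f := Hom.ext (Category.comp_id _)
    (ThetaEnvData.Iso.ext' (MulEquiv.ext fun _ => rfl) (MulEquiv.ext fun _ => rfl) (Equiv.ext fun _ => rfl))
  assoc f g h := Hom.ext (Category.assoc _ _ _)
    (ThetaEnvData.Iso.ext' (MulEquiv.ext fun _ => rfl) (MulEquiv.ext fun _ => rfl) (Equiv.ext fun _ => rfl))

/-- The group-isomorphism component of a morphism (bookkeeping). [cite: Mochizuki2012, Prop 3.4 (i) p.91] -/
theorem comp_iso {X Y Z : ThetaMonoidDatum S} (f : X ⟶ Y) (g : Y ⟶ Z) : (f ≫ g).iso = f.iso ≫ g.iso := rfl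

/-- The data-isomorphism component of a composite (bookkeeping). [cite: Mochizuki2012, Prop 3.4 (i) p.91] -/
theorem comp_I {X Y Z : ThetaMonoidDatum S} (f : X ⟶ Y) (g : Y ⟶ Z) : (f ≫ g).I = f.I.trans g.I := rfl

/-- The identity morphism (bookkeeping). [cite: Mochizuki2012, Prop 3.4 (i) p.91] -/
theorem id_I (X : ThetaMonoidDatum S) : (𝟙 X : X ⟶ X).I = ThetaEnvData.Iso.refl X.E := rfl

/-- Every morphism is invertible: `ThetaMonoidDatum S` is a GROUPOID ("isomorphisms", p. 91).
[cite: Mochizuki2012, Prop 3.4 (i) p.91] -/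
instance : Groupoid.{u} (ThetaMonoidDatum S) where
  inv f := ⟨Groupoid.inv f.iso, f.I.symm, fun y => by
    change f.I.phi.symm y = (IsoClass.homIso f.iso).symm y
    apply (IsoClass.homIso f.iso).injective
    rw [ContinuousMulEquiv.apply_symm_apply, ← f.phi_eq, MulEquiv.apply_symm_apply]⟩
  inv_comp f := Hom.ext (Groupoid.inv_comp f.iso)
    (ThetaEnvData.Iso.ext' (MulEquiv.ext fun x => f.I.phi.apply_symm_apply x)
      (MulEquiv.ext fun x => f.I.e.apply_symm_apply x) (Equiv.ext fun x => f.I.iota.apply_symm_apply x))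
  comp_inv f := Hom.ext (Groupoid.comp_inv f.iso)
    (ThetaEnvData.Iso.ext' (MulEquiv.ext fun x => f.I.phi.symm_apply_apply x)
      (MulEquiv.ext fun x => f.I.e.symm_apply_apply x) (Equiv.ext fun x => f.I.iota.symm_apply_apply x))

/-- **First display of Prop 3.4 (i), middle row** (p. 91): a morphism carries `Ψ^ι_env(Π)` onto
`Ψ^{ι'}_env(Π*)` (abc-iut-L6-t2's `Iso.map_thetaMonoid`). [cite: Mochizuki2012, Prop 3.4 (i) p.91] -/
theorem map_thetaMonoid {X Y : ThetaMonoidDatum S} (f : X ⟶ Y) (ι : X.E.Iota) :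
    (X.E.thetaMonoid ι).map f.I.e = Y.E.thetaMonoid (f.I.iota ι) :=
  f.I.map_thetaMonoid ι

/-- **First display of Prop 3.4 (i), `∞`-row** (p. 91): a morphism carries `∞Ψ^ι_env(Π)` onto `∞Ψ^{ι'}_env(Π*)`.
[cite: Mochizuki2012, Prop 3.4 (i) p.91] -/
theorem map_inftyThetaMonoid {X Y : ThetaMonoidDatum S} (f : X ⟶ Y) (ι : X.E.Iota) :
    (X.E.inftyThetaMonoid ι).map f.I.e = Y.E.inftyThetaMonoid (f.I.iota ι) :=
  f.I.map_inftyThetaMonoid ι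

/-- **Second display of Prop 3.4 (i)/(ii)** (pp. 91–92): a morphism carries `M^×_TM(Π) = Ψ^×` onto `M^×_TM(Π*)`.
[cite: Mochizuki2012, Prop 3.4 (i) p.91] -/
theorem map_units {X Y : ThetaMonoidDatum S} (f : X ⟶ Y) :
    X.E.units.toSubmonoid.map f.I.e = Y.E.units.toSubmonoid :=
  f.I.map_units_toSubmonoid

/-- **First display of Prop 3.4 (ii)** (p. 92): a morphism carries `Ψ_cns(Π)` onto `Ψ_cns(Π*)`.
[cite: Mochizuki2012, Prop 3.4 (ii) p.92] -/
theorem map_constantMonoid {X Y : ThetaMonoidDatum S} (f : X ⟶ Y) :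
    X.E.constantMonoid.map f.I.e = Y.E.constantMonoid :=
  f.I.map_constantMonoid

/-- A morphism induces abc-iut-L6-t2's isomorphism of Galois–monoid PAIRS
`(Π ↷ Ψ^ι_env) ⥲ (Π* ↷ Ψ^{ι'}_env)` on the output pairs of Prop 3.4 (i) (`splitThetaPairIso`), given the
stability/continuity hypotheses under which the pairs are formed. [cite: Mochizuki2012, Prop 3.4 (i) p.91] -/
noncomputable def splitThetaPairIso {X Y : ThetaMonoidDatum S} (f : X ⟶ Y) (ι : X.E.Iota)
    (hS : X.E.IsConjStable (X.E.thetaMonoid ι))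
    (hopen : ∀ x : X.E.thetaMonoid ι, IsOpen {g : X.P.G | X.E.conj g x = x})
    (hS' : Y.E.IsConjStable (Y.E.thetaMonoid (f.I.iota ι)))
    (hopen' : ∀ y : Y.E.thetaMonoid (f.I.iota ι), IsOpen {g' : Y.P.G | Y.E.conj g' y = y}) :
    GaloisMonoidPair.Iso (X.E.splitThetaPair ι hS hopen) (Y.E.splitThetaPair (f.I.iota ι) hS' hopen') :=
  f.I.splitThetaPairIso (IsoClass.homIso f.iso) (fun g => (f.phi_eq g).symm) ι hS hopen hS' hopen'

/-- … and `(Π ↷ ∞Ψ^ι_env) ⥲ (Π* ↷ ∞Ψ^{ι'}_env)` (`inftySplitThetaPairIso`). [cite: Mochizuki2012, Prop 3.4 (i) p.91] -/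
noncomputable def inftySplitThetaPairIso {X Y : ThetaMonoidDatum S} (f : X ⟶ Y) (ι : X.E.Iota)
    (hS : X.E.IsConjStable (X.E.inftyThetaMonoid ι))
    (hopen : ∀ x : X.E.inftyThetaMonoid ι, IsOpen {g : X.P.G | X.E.conj g x = x})
    (hS' : Y.E.IsConjStable (Y.E.inftyThetaMonoid (f.I.iota ι)))
    (hopen' : ∀ y : Y.E.inftyThetaMonoid (f.I.iota ι), IsOpen {g' : Y.P.G | Y.E.conj g' y = y}) :
    GaloisMonoidPair.Iso (X.E.inftySplitThetaPair ι hS hopen) (Y.E.inftySplitThetaPair (f.I.iota ι) hS' hopen') :=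
  f.I.inftySplitThetaPairIso (IsoClass.homIso f.iso) (fun g => (f.phi_eq g).symm) ι hS hopen hS' hopen'

end ThetaMonoidDatum

/-! ### 2. The input: theta-environment data on every isomorph, functorially (junction J10 as DATA) -/

/-- **The functoriality input of Prop 3.4** (p. 91: "Each isomorphism of projective systems of mono-theta
environments `M^Θ_*(Π_v) ⥲ M^Θ_*(†F_v)` induces compatible collections of isomorphisms …; the left-hand square in
each diagram arises from the functoriality of the algorithms involved, relative to isomorphisms of projective
systems of mono-theta environments"; Prop 1.2 (i): the functorial algorithm `Π ↦ M^Θ_*(Π)`), as a DATA package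
(junction J10 of the sub-DAG; not a `Prop` fact): theta-environment data `E(Π)` on every isomorph `Π` of
`Π^tp_{X̲̲_k}` and, for every isomorphism of topological groups `f : Π ⥲ Π*`, an isomorphism of data
`E(Π) ⥲ E(Π*)` ALONG `f`, compatible with identities and composition on the module and index components (the
group component is `f` itself).  Its genuine inhabitant is the natural-system record of the group-theoretic
construction (abc-iut-w4-d019's `EtaleLevels.thetaEnvRecord` family); a degenerate inhabitant is `trivial`.
[cite: Mochizuki2012, Prop 3.4 (i) p.91] -/
structure ThetaEnvTransport : Type (u + 1) where
  /-- the theta-environment data on the isomorph `Π` -/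
  E : ∀ P : IsoClass S.PiX, ThetaEnvData.{u, u} P.G
  /-- the isomorphism of data induced by an isomorphism of topological groups `Π ⥲ Π*` -/
  iso : ∀ {P P' : IsoClass S.PiX} (f : P ⟶ P'), ThetaEnvData.Iso (E P) (E P')
  /-- … whose group component is the given isomorphism -/
  iso_phi : ∀ {P P' : IsoClass S.PiX} (f : P ⟶ P') (g : P.G), (iso f).phi g = IsoClass.homIso f g
  /-- the identity induces the identity on the ambient module … -/
  iso_id_e : ∀ (P : IsoClass S.PiX) (x : (E P).H), (iso (𝟙 P)).e x = x
  /-- … and on the inversion automorphisms `ι` -/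
  iso_id_iota : ∀ (P : IsoClass S.PiX) (ι : (E P).Iota), (iso (𝟙 P)).iota ι = ι
  /-- composites induce composites on the ambient module … -/
  iso_comp_e : ∀ {P P' P'' : IsoClass S.PiX} (f : P ⟶ P') (g : P' ⟶ P'') (x : (E P).H),
    (iso (f ≫ g)).e x = (iso g).e ((iso f).e x)
  /-- … and on the inversion automorphisms -/
  iso_comp_iota : ∀ {P P' P'' : IsoClass S.PiX} (f : P ⟶ P') (g : P' ⟶ P'') (ι : (E P).Iota),
    (iso (f ≫ g)).iota ι = (iso g).iota ((iso f).iota ι)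

namespace ThetaEnvTransport

variable {S}

/-- The identity induces the identity isomorphism of data (packaged form of the `id` laws).
[cite: Mochizuki2012, Prop 3.4 (i) p.91] -/
theorem iso_id (T : ThetaEnvTransport S) (P : IsoClass S.PiX) : T.iso (𝟙 P) = ThetaEnvData.Iso.refl (T.E P) :=
  ThetaEnvData.Iso.ext' (MulEquiv.ext fun g => by rw [T.iso_phi]; rfl) (MulEquiv.ext (T.iso_id_e P))
    (Equiv.ext (T.iso_id_iota P))

/-- Composites induce composite isomorphisms of data (packaged form of the `comp` laws).
[cite: Mochizuki2012, Prop 3.4 (i) p.91] -/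
theorem iso_comp (T : ThetaEnvTransport S) {P P' P'' : IsoClass S.PiX} (f : P ⟶ P') (g : P' ⟶ P'') :
    T.iso (f ≫ g) = (T.iso f).trans (T.iso g) :=
  ThetaEnvData.Iso.ext'
    (MulEquiv.ext fun x => by
      change (T.iso (f ≫ g)).phi x = (T.iso g).phi ((T.iso f).phi x)
      rw [T.iso_phi, T.iso_phi, T.iso_phi]
      rfl)
    (MulEquiv.ext (T.iso_comp_e f g)) (Equiv.ext (T.iso_comp_iota f g))

/-- The DEGENERATE theta-environment datum on a group: trivial ambient module, trivial action, one inversion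
index, empty theta sets (interface non-vacuity only; NOT the genuine data of Prop 3.1). [folklore] -/
def trivialData (P : Type u) [Group P] : ThetaEnvData.{u, u} P where
  H := CommGrpCat.of PUnit.{u + 1}
  conj := 1
  Iota := PUnit.{u + 1}
  units := ⊤
  constants := ⊤
  units_eq := fun _ => by simp
  thetaEnv := fun _ => ∅
  inftyThetaEnv := fun _ => ∅
  theta_subset := fun _ => le_rfl

/-- The isomorphism of degenerate data along any group isomorphism. [folklore] -/
def trivialIso {P P' : Type u} [Group P] [Group P'] (φ : P ≃* P') :
    ThetaEnvData.Iso (trivialData P) (trivialData P') where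
  phi := φ
  e := MulEquiv.refl _
  iota := Equiv.refl _
  map_conj _ _ := rfl
  map_units := by
    change (⊤ : Subgroup PUnit).map _ = ⊤
    refine SetLike.coe_injective ?_
    simp only [Subgroup.coe_map, Subgroup.coe_top, Set.image_univ]
    exact Set.range_eq_univ.mpr fun y => ⟨y, rfl⟩
  map_constants := by
    change (⊤ : Submonoid PUnit).map _ = ⊤
    refine SetLike.coe_injective ?_
    simp only [Submonoid.coe_map, Submonoid.coe_top, Set.image_univ]
    exact Set.range_eq_univ.mpr fun y => ⟨y, rfl⟩
  image_thetaEnv _ := by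
    change _ '' (∅ : Set PUnit) = ∅
    simp
  image_inftyThetaEnv _ := by
    change _ '' (∅ : Set PUnit) = ∅
    simp

variable (S) in
/-- A DEGENERATE inhabitant of the transport input: the degenerate datum on every isomorph, transported along
every isomorphism by the identity (interface non-vacuity: the package `ThetaEnvTransport` is consistent; the
GENUINE inhabitant is the natural-system record family, not built here). [folklore] -/
def trivial : ThetaEnvTransport S where
  E P := trivialData P.G
  iso f := trivialIso (IsoClass.homIso f).toMulEquiv
  iso_phi _ _ := rfl
  iso_id_e _ _ := rfl
  iso_id_iota _ _ := rfl
  iso_comp_e _ _ _ := rfl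
  iso_comp_iota _ _ _ := rfl

end ThetaEnvTransport

/-! ### 3. THE functor of Prop 3.4 (i) and its composite with the radial category of Example 1.8 (iii)/(iv) -/

variable {S}

/-- **The functorial algorithm `Π_v ↦ (Π_v ↷ Ψ_env(M^Θ_*(Π_v)), ∞Ψ_env(M^Θ_*(Π_v)))` of Prop 3.4 (i)**
(p. 91) as a functor on the isomorphs of `Π^tp_{X̲̲_k}`: `Π ↦ (Π, E(Π))`, an isomorphism `Π ⥲ Π*` going to the
induced "compatible collection of isomorphisms"; functor laws PROVED from the transport laws.
[cite: Mochizuki2012, Prop 3.4 (i) p.91] -/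
def thetaMonoidFunctor (T : ThetaEnvTransport S) : IsoClass S.PiX ⥤ ThetaMonoidDatum S where
  obj P := ⟨P, T.E P⟩
  map f := ⟨f, T.iso f, T.iso_phi f⟩
  map_id P := ThetaMonoidDatum.Hom.ext rfl (T.iso_id P)
  map_comp f g := ThetaMonoidDatum.Hom.ext rfl (T.iso_comp f g)

/-- On objects the functor is `Π ↦ (Π, E(Π))` (bookkeeping). [cite: Mochizuki2012, Prop 3.4 (i) p.91] -/
theorem thetaMonoidFunctor_obj (T : ThetaEnvTransport S) (P : IsoClass S.PiX) :
    (thetaMonoidFunctor T).obj P = ⟨P, T.E P⟩ := rfl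

/-- On morphisms the functor is the induced isomorphism of data (bookkeeping). [cite: Mochizuki2012, Prop 3.4 (i) p.91] -/
theorem thetaMonoidFunctor_map_I (T : ThetaEnvTransport S) {P P' : IsoClass S.PiX} (f : P ⟶ P') :
    ((thetaMonoidFunctor T).map f).I = T.iso f := rfl

/-- **The functor on the radial category** `ℛ = (ex18iii S Γ).R` of Example 1.8 (iii)/(iv) (radial data
`(Π, G, α)`, morphisms `(Π ⥲ Π*, (G ⥲ G*, γ ∈ Γ))`, `Γ` the group of `Ism`-multiples of Cor 1.12 (iii) kept
abstract as in abc-iut-L6-t1's shape): the algorithm only reads `Π`, so the functor is the composite with the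
projection `(Π, G, α) ↦ Π` (Example 1.9 (i): `ℛ → ℰ`). [cite: Mochizuki2012, Prop 3.4 (i) p.92] -/
def prop34iRadialFunctor (T : ThetaEnvTransport S) (Γ : Type u) [Group Γ] :
    IsoClass S.PiX × TwistedIsoClass S.Gk Γ ⥤ ThetaMonoidDatum S :=
  CategoryTheory.Prod.fst (IsoClass S.PiX) (TwistedIsoClass S.Gk Γ) ⋙ thetaMonoidFunctor T

/-! ### 4. J12 — Prop 3.4 (i): "the natural functor `Ψ_ℛ` … is multiradially defined" at this functor -/

/-- **[IUTchII] Prop 3.4 (i), multiradiality of split theta monoids — the INSTANCE (junction J12)**: for the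
functor `Π_v ↦ (Π_v ↷ Ψ_env(M^Θ_*(Π_v)), ∞Ψ_env(M^Θ_*(Π_v)))` built from ANY functoriality input `T`, on the
radial category of Example 1.8 (iii)/(iv) with twisting group `Γ` (the `Ism`-multiples of Cor 1.12 (iii)), "the
natural functor `Ψ_ℛ` of Corollary 1.12, (iii), is multiradially defined" — LITERALLY abc-iut-L6-t1's shape
theorem `cor111_multiradiallyDefined S Γ Ξ` at `Ξ := prop34iRadialFunctor T Γ` (printed proof of Cor 1.11/1.12:
"follow immediately from the definitions"). [cite: Mochizuki2012, Prop 3.4 (i) p.92] -/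
theorem prop34i_multiradiallyDefined (T : ThetaEnvTransport S) (Γ : Type u) [Group Γ] :
    ((ex18iii S Γ).toDagger (prop34iRadialFunctor T Γ)).IsMultiradiallyDefined :=
  cor111_multiradiallyDefined S Γ (prop34iRadialFunctor T Γ)

/-- **The Example 1.9 (ii) form** (kurims p. 42: "any functorial group-theoretic algorithm whose input data
consists of a topological group isomorphic to `Π^tp_{X̲̲_k}` gives rise … to a multiradially defined functor"),
at the functor of Prop 3.4 (i) on the radial environment of Example 1.8 (i) — abc-iut-L6-t1's
`ex19ii_multiradiallyDefined`, instantiated. [cite: Mochizuki2012, Ex 1.9 (ii) p.42] -/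
theorem thetaMonoidFunctor_ex19ii (T : ThetaEnvTransport S) :
    ((ex18i S).toDagger (CategoryTheory.Prod.fst _ _ ⋙ thetaMonoidFunctor T)).IsMultiradiallyDefined :=
  ex19ii_multiradiallyDefined S (thetaMonoidFunctor T)

/-- NON-VACUITY of the statement shape: the multiradiality instance at the degenerate transport input (so the
theorem is not about an empty family of functors). [folklore] -/
example (Γ : Type u) [Group Γ] :
    ((ex18iii S Γ).toDagger (prop34iRadialFunctor (ThetaEnvTransport.trivial S) Γ)).IsMultiradiallyDefined :=
  prop34i_multiradiallyDefined (ThetaEnvTransport.trivial S) Γ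

end TemperedThetaMonoids

end Literature.IUT.HodgeArakelov
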